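import Summits.AtomisticToContinuum.BoseEinsteinCondensation.Theorems.BECRichardsonGaudinRichardsonAnchorBECDefs
import Literature.MathematicalPhysics.QuantumManyBody.TorusFockSectorDictionary
import HarnessLib

/-!
# Route `BECRichardsonGaudin`, crux `RichardsonAnchorBEC` (stmt-AtomisticToContinuum-14805), line `registered` —
# vocabulary of the Born trial state (stub `stub_bornTrialState`)

Second `Defs` file of the line (lead prover): the OBJECTS of the upper-bound stub U. The trial state is the
sector trial state (`TorusFockSectorDictionary.sectorTrialState`) of an explicit homogeneous polynomial over the
band modes `ι = ↥(momentumBand M)` — a number-conserving, pair-number-windowed pair condensate with infrared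
cut pair amplitudes:

  `A = Σ_{j ≤ J₁} Σ_{S ⊆ W₊, |S| = j} λ_j θ^S · X_0^{N−2j} ∏_{m ∈ S} X_m X_{−m}`,

with `W = B_M ∖ B_R` (`pairWindow`, the infrared window), `W₊` its lexicographically positive half
(`pairReps`, one representative per pair `±m`), `θ_m = 1/|2πm/L|²` (`modeWeight`), `λ_j = (−c)^j N!/(N−2j)!`
(`bornCoeff`), `c = γ/(2L³(1 + γJ_W))` (`bornCoupling`), `J_W = (1/2L³) Σ_{m∈W} 1/|k_m|²` (`windowBubble`, the
bubble of the window, `≤ bandBubble`). The ratio `λ_{j+1}/λ_j = −c(N−2j)(N−2j−1)` makes the pair operator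
`P = Σ_{k∈B} a_{−k}a_k` act on `A` sector by sector as multiplication by `(1 − β) + (β/σ)·(Σ_{m∈S} θ_m)`,
`β = γJ_W/(1+γJ_W)`, `σ = Σ_{W₊} θ = L³J_W` — the second-Born (pair-bubble) renormalisation `γ → γ/(1+γJ_W)`
realised by a NUMBER-CONSERVING state. Also: `toBand` (total embedding `ℤ³ → ↥B_M`), the time-reversal `Neg`
structure on `↥B_M`, `pairIndex` (the occupation multi-index of `(j, S)`), `pairEsymm` (the elementary
symmetric functions `e_j(θ²)` over `W₊`, i.e. the Fock norms of the `j`-pair sectors), and the registered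
vocabulary witness `stub_bornDefs`. Definitions of a proof plan; no statement of the crux is restated. [folklore]
-/

noncomputable section

namespace Summit.AtomisticToContinuum.BoseEinsteinCondensation.Cruxes.RichardsonAnchorBEC.Birth

open MeasureTheory Filter MvPolynomial
open scoped ENNReal NNReal BigOperators
open Literature.MathematicalPhysics.QuantumManyBody.BoseGas

/-! ## The infrared window and its positive half -/

/-- Lexicographic positivity on `ℤ³`: `m >_lex 0`. For `m ≠ 0` exactly one of `m`, `−m` is lex-positive, so
`lexPos` selects one representative of each time-reversal pair `{m, −m}`. [folklore] -/
def lexPos (m : Momentum) : Prop :=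
  0 < m 0 ∨ (m 0 = 0 ∧ (0 < m 1 ∨ (m 1 = 0 ∧ 0 < m 2)))

/-- `lexPos` is decidable (a Boolean combination of integer comparisons). [folklore] -/
instance instDecidablePredLexPos : DecidablePred lexPos := fun m => by
  unfold lexPos; infer_instance

/-- The **infrared window** `W = B_M ∖ B_R = {m ∈ ℤ³ : R < |m|∞ ≤ M}` of pair modes carrying the trial
state's pair amplitudes (symmetric under `m ↦ −m`, `0 ∉ W`). [folklore] -/
def pairWindow (M R : ℕ) : Finset Momentum :=
  momentumBand M \ momentumBand R

/-- The lex-positive half `W₊` of the window: one representative `m` of each pair `{m, −m} ⊆ W`. [folklore] -/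
def pairReps (M R : ℕ) : Finset Momentum :=
  (pairWindow M R).filter lexPos

/-! ## Band modes: total embedding and time reversal -/

/-- Total embedding `ℤ³ → ↥B_M` (junk value `0` off the band), so that `X (toBand M m)` is the creation
variable of the band mode `m` without a membership proof in the term. [folklore] -/
def toBand (M : ℕ) (m : Momentum) : ↥(momentumBand M) :=
  if h : m ∈ momentumBand M then ⟨m, h⟩ else ⟨0, zero_mem_momentumBand M⟩

/-- On the band `toBand` is the identity on values. [folklore] -/
theorem toBand_val {M : ℕ} {m : Momentum} (h : m ∈ momentumBand M) : (toBand M m).1 = m := by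
  simp [toBand, h]

/-- Time reversal `k ↦ −k` on the band modes (the band is symmetric, `neg_mem_momentumBand`); with it
`Fock.pairAn p = a_{−p} a_p` and `Fock.bandPairAn univ = Σ_{k ∈ B_M} a_{−k} a_k = P_{B_M}` on
`MvPolynomial ↥(momentumBand M) ℂ`. [folklore] -/
instance instNegBandMode (M : ℕ) : Neg ↥(momentumBand M) :=
  ⟨fun p => ⟨-p.1, neg_mem_momentumBand p.2⟩⟩

/-- The value of the time-reversed band mode. [folklore] -/
@[simp] theorem neg_bandMode_val {M : ℕ} (p : ↥(momentumBand M)) : (-p).1 = -p.1 := rfl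

/-! ## Weights, bubbles, coefficients -/

/-- The pair amplitude shape `θ_m = 1/|k_m|²`, `k_m = 2πm/L` (the zero-energy pair propagator; `θ_0 = 0` by
`1/0 = 0`). [folklore] -/
def modeWeight (L : ℝ) (m : Momentum) : ℝ :=
  1 / ‖waveVector L m‖ ^ 2

/-- The **window bubble** `J_W(L) = (1/2L³) Σ_{m ∈ W} 1/|k_m|²` (`≤ bandBubble L M`, with equality for `R = 0`).
[folklore] -/
def windowBubble (L : ℝ) (M R : ℕ) : ℝ :=
  1 / (2 * L ^ 3) * ∑ m ∈ pairWindow M R, modeWeight L m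

/-- The **renormalised pair coupling** `c = γ/(2L³(1 + γJ_W))` (`= (g/2)/(1+γJ_W)`, `g = γ/L³`): the ratio
`λ_{j+1}/λ_j = −c (N−2j)(N−2j−1)` of consecutive pair-number amplitudes. [folklore] -/
def bornCoupling (γ L : ℝ) (M R : ℕ) : ℝ :=
  γ / (2 * L ^ 3 * (1 + γ * windowBubble L M R))

/-- The **pair-number amplitudes** `λ_j = (−c)^j · N!/(N−2j)!` (`N.descFactorial (2j) = N(N−1)⋯(N−2j+1)`).
[folklore] -/
def bornCoeff (γ L : ℝ) (M R N j : ℕ) : ℝ :=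
  (-bornCoupling γ L M R) ^ j * (N.descFactorial (2 * j) : ℝ)

/-- The **elementary symmetric functions of the squared weights over `W₊`**:
`e_j = Σ_{S ⊆ W₊, |S| = j} ∏_{m∈S} θ_m²` — the Fock norm of the `j`-pair sector `Σ_S θ^S ∏ X_mX_{−m}`
(all its monomials are distinct with unit occupation factorials). [folklore] -/
def pairEsymm (L : ℝ) (M R j : ℕ) : ℝ :=
  ∑ S ∈ (pairReps M R).powersetCard j, ∏ m ∈ S, modeWeight L m ^ 2

/-! ## The trial polynomial -/

/-- The occupation multi-index of the sector `(j, S)`: `(N − 2|S|) e_0 + Σ_{m∈S} (e_m + e_{−m})`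
(`N − 2|S|` condensate particles and the pairs `±m`, `m ∈ S`). [folklore] -/
def pairIndex (M N : ℕ) (S : Finset Momentum) : ↥(momentumBand M) →₀ ℕ :=
  Finsupp.single (toBand M 0) (N - 2 * S.card) +
    ∑ m ∈ S, (Finsupp.single (toBand M m) 1 + Finsupp.single (toBand M (-m)) 1)

/-- **The Born trial polynomial** (degree `N`, over the band modes):
`A = Σ_{j=0}^{J₁} Σ_{S ⊆ W₊, |S| = j} (λ_j ∏_{m∈S} θ_m) · X^{pairIndex S}` — a superposition over the pair number
`j ≤ J₁` of hard-core pair sectors with amplitudes `θ_m = 1/|k_m|²` on the infrared window. Its sector trial state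
is the number-conserving Born-renormalised trial state of stub U. [folklore] -/
def bornTrialPoly (γ L : ℝ) (M R N J₁ : ℕ) : MvPolynomial ↥(momentumBand M) ℂ :=
  ∑ j ∈ Finset.range (J₁ + 1), ∑ S ∈ (pairReps M R).powersetCard j,
    monomial (pairIndex M N S) (((bornCoeff γ L M R N j * ∏ m ∈ S, modeWeight L m : ℝ)) : ℂ)

/-! ## Registered vocabulary witness -/

/-- **Vocabulary stub** of the Born trial state: the window's positive half lies in the window, the window in
the band and off the zero mode. [folklore] -/
theorem stub_bornDefs :
    ∀ M R : ℕ, pairReps M R ⊆ pairWindow M R ∧ pairWindow M R ⊆ momentumBand M ∧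
      (0 : Momentum) ∉ pairWindow M R := by
  intro M R
  refine ⟨Finset.filter_subset _ _, Finset.sdiff_subset, fun h => ?_⟩
  exact (Finset.mem_sdiff.1 h).2 (zero_mem_momentumBand R)

end Summit.AtomisticToContinuum.BoseEinsteinCondensation.Cruxes.RichardsonAnchorBEC.Birth

end
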